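import Mathlib
import Literature.MathematicalPhysics.StatisticalMechanics.BarlowStacking
import Literature.MathematicalPhysics.StatisticalMechanics.LennardJonesClusters

/-!
# Knabe-type compactness: a local non-negative term with a perfect zero set is uniformly positive off the germ

Stub `stub_knabeCompactness` of the line `frustration-free-census-germ` for the crux
`PricedLinkCensus.TruncatedCensusGap` (item stmt-AtomisticToContinuum-14230), registered by
`ledger skeleton check` on the skeleton `Cruxes/TruncatedCensusGap/Lines/frustration_free_census_germ.lean`.
The statement below is the registered signature VERBATIM (self-contained over tree declarations).

Pure analysis (Bolzano–Weierstrass on bounded separated stars); see the theorem docstring for the route.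
-/

noncomputable section

namespace Summit.AtomisticToContinuum.Crystallization.Theorems.PricedLinkCensusTruncatedCensusGap

open scoped BigOperators
open Literature.MathematicalPhysics.StatisticalMechanics

/-- A positive real function on a finite type admits a uniform positive lower bound. -/
private theorem exists_pos_le_of_finite {ι : Type*} [Finite ι] (f : ι → ℝ) (hf : ∀ x, 0 < f x) :
    ∃ κ : ℝ, 0 < κ ∧ ∀ x, κ ≤ f x := by
  rcases isEmpty_or_nonempty ι with hι | hι
  · exact ⟨1, one_pos, fun x => (IsEmpty.false x).elim⟩
  · obtain ⟨x₀, hx₀⟩ := Finite.exists_min f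
    exact ⟨f x₀, hf x₀, hx₀⟩

/-- The spacing window `|c - a√(2/3)| ≤ a√(2/3)/250` forces `3a/4 ≤ c` (as `4/5 ≤ √(2/3)`). -/
private theorem three_quarters_le_of_window {a c : ℝ} (ha : 0 < a)
    (hwin : |c - a * Real.sqrt (2 / 3)| ≤ a * Real.sqrt (2 / 3) / 250) : 3 * a / 4 ≤ c := by
  have hs : (4 : ℝ) / 5 ≤ Real.sqrt (2 / 3) := Real.le_sqrt_of_sq_le (by norm_num)
  have h1 := (abs_le.1 hwin).1
  have h2 : a * (4 / 5) ≤ a * Real.sqrt (2 / 3) := mul_le_mul_of_nonneg_left hs ha.le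
  linarith

/-- **Perturbative transfer of a perfect germ.** If `x` is injective and matched exactly, both
ways, with the Barlow image `g '' barlowStacking a c s` within `4a` of `x i` (`3a/4 ≤ c`), then
every configuration `w` that is sitewise `ε`-close to `x` (`ε ≤ δa`, `ε ≤ a/8`) is `δ`-germ-matched
within `3a` of `w i` with the same data: `a/2`-separated, sites near Barlow points and conversely. -/
private theorem germMatched_of_close {M : ℕ}
    {x w : Fin M → EuclideanSpace ℝ (Fin 3)} {i : Fin M} {a c δ ε : ℝ} {s : ℤ → ℤ}
    {g : EuclideanSpace ℝ (Fin 3) ≃ᵃⁱ[ℝ] EuclideanSpace ℝ (Fin 3)}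
    (ha : 0 < a) (hc : 3 * a / 4 ≤ c) (hεδ : ε ≤ δ * a) (hεa : ε ≤ a / 8)
    (hinj : Function.Injective x)
    (hm1 : ∀ j : Fin M, dist (x j) (x i) ≤ 4 * a → ∃ z ∈ barlowStacking a c s, x j = g z)
    (hm2 : ∀ z ∈ barlowStacking a c s, dist (g z) (x i) ≤ 4 * a → ∃ j : Fin M, x j = g z)
    (hclose : ∀ j, dist (w j) (x j) ≤ ε) :
    (∀ j k : Fin M, j ≠ k → dist (w j) (w i) ≤ 3 * a → a / 2 ≤ dist (w j) (w k)) ∧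
    (∀ j : Fin M, dist (w j) (w i) ≤ 3 * a →
        ∃ z ∈ barlowStacking a c s, dist (w j) (g z) ≤ δ * a) ∧
    (∀ z ∈ barlowStacking a c s, dist (g z) (w i) ≤ 3 * a →
        ∃ j : Fin M, dist (w j) (g z) ≤ δ * a) := by
  -- a site of `w` within `3a` of `w i` comes from a site of `x` within `3a + 2ε ≤ 4a` of `x i`
  have hxw : ∀ j, dist (w j) (w i) ≤ 3 * a → dist (x j) (x i) ≤ 3 * a + 2 * ε := by
    intro j hj
    have h1 : dist (x j) (x i) ≤ dist (x j) (w j) + dist (w j) (w i) + dist (w i) (x i) :=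
      dist_triangle4 _ _ _ _
    rw [dist_comm (x j) (w j)] at h1
    linarith [hclose j, hclose i]
  have h4a : ∀ j, dist (w j) (w i) ≤ 3 * a → dist (x j) (x i) ≤ 4 * a := fun j hj => by
    linarith [hxw j hj]
  refine ⟨?_, ?_, ?_⟩
  · intro j k hjk hj
    obtain ⟨z, hz, hxj⟩ := hm1 j (h4a j hj)
    have hjk' : dist (x j) (x k) ≤ dist (w j) (w k) + 2 * ε := by
      have h1 : dist (x j) (x k) ≤ dist (x j) (w j) + dist (w j) (w k) + dist (w k) (x k) :=
        dist_triangle4 _ _ _ _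
      rw [dist_comm (x j) (w j)] at h1
      linarith [hclose j, hclose k]
    by_cases hk : dist (x k) (x i) ≤ 4 * a
    · -- both are exact Barlow points: uniform discreteness of the stacking
      obtain ⟨z', hz', hxk⟩ := hm1 k hk
      have hzz' : z ≠ z' := fun hzz => hjk (hinj (by rw [hxj, hxk, hzz]))
      have h1 : min a c ≤ dist z z' :=
        le_dist_of_mem_barlowStacking a c s ha.le (by linarith) hz hz' hzz'
      have h2 : 3 * a / 4 ≤ dist (x j) (x k) := by
        rw [hxj, hxk, g.dist_map]
        exact (le_min (by linarith) hc).trans h1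
      linarith
    · -- `x k` is far from the root
      rw [not_le] at hk
      have h1 : dist (x k) (x i) ≤ dist (x k) (x j) + dist (x j) (x i) := dist_triangle _ _ _
      rw [dist_comm (x k) (x j)] at h1
      linarith [hxw j hj]
  · intro j hj
    obtain ⟨z, hz, hxj⟩ := hm1 j (h4a j hj)
    exact ⟨z, hz, by rw [← hxj]; exact (hclose j).trans hεδ⟩
  · intro z hz hzi
    have h1 : dist (g z) (x i) ≤ 4 * a := by
      have h2 : dist (g z) (x i) ≤ dist (g z) (w i) + dist (w i) (x i) := dist_triangle _ _ _
      linarith [hclose i]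
    obtain ⟨j, hxj⟩ := hm2 z hz h1
    exact ⟨j, by rw [← hxj]; exact (hclose j).trans hεδ⟩

/-- **Knabe-type compactness.** A site functional on finite configurations of `ℝ³` that is `R`-local, isometry-invariant, non-negative, lower semicontinuous (at injective configurations), floored by `h₀` on stars with a pair closer than `r₀` inside the `R`-ball, and vanishes only on perfect Barlow `4a`-germs (`4a ≤ R`, spacing window `±1/250`), is bounded below by some `κ(δ) > 0` at every site that is not `δ`-germ-matched, for each `δ ∈ (0, 1/2]`. [folklore] -/
theorem stub_knabeCompactness :
    ∀ (h : (N : ℕ) → (Fin N → EuclideanSpace ℝ (Fin 3)) → Fin N → ℝ) (R r₀ h₀ : ℝ),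
      0 < r₀ → 0 < h₀ →
      (∀ (N M : ℕ) (y : Fin N → EuclideanSpace ℝ (Fin 3)) (f : Fin M ↪ Fin N) (i : Fin M),
        (∀ j : Fin N, dist (y j) (y (f i)) ≤ R → j ∈ Set.range f) →
        h M (y ∘ f) i = h N y (f i)) →
      (∀ (N : ℕ) (y : Fin N → EuclideanSpace ℝ (Fin 3)) (i : Fin N)
        (g : EuclideanSpace ℝ (Fin 3) ≃ᵢ EuclideanSpace ℝ (Fin 3)), h N (g ∘ y) i = h N y i) →
      (∀ (N : ℕ) (y : Fin N → EuclideanSpace ℝ (Fin 3)) (i : Fin N), Function.Injective y →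
        0 ≤ h N y i) →
      (∀ (N : ℕ) (y : Fin N → EuclideanSpace ℝ (Fin 3)) (i : Fin N), Function.Injective y →
        LowerSemicontinuousAt (fun y' : Fin N → EuclideanSpace ℝ (Fin 3) => h N y' i) y) →
      (∀ (N : ℕ) (y : Fin N → EuclideanSpace ℝ (Fin 3)) (i : Fin N), Function.Injective y →
        (∃ j k : Fin N, j ≠ k ∧ dist (y j) (y i) ≤ R ∧ dist (y k) (y i) ≤ R ∧
            dist (y j) (y k) < r₀) →
        h₀ ≤ h N y i) →
      (∀ (N : ℕ) (y : Fin N → EuclideanSpace ℝ (Fin 3)) (i : Fin N), Function.Injective y →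
        h N y i = 0 →
        ∃ (a c : ℝ) (s : ℤ → ℤ)
            (g : EuclideanSpace ℝ (Fin 3) ≃ᵃⁱ[ℝ] EuclideanSpace ℝ (Fin 3)),
          0 < a ∧ 4 * a ≤ R ∧ IsHaggSeq s ∧
          |c - a * Real.sqrt (2 / 3)| ≤ a * Real.sqrt (2 / 3) / 250 ∧
          (∀ j : Fin N, dist (y j) (y i) ≤ 4 * a → ∃ z ∈ barlowStacking a c s, y j = g z) ∧
          (∀ z ∈ barlowStacking a c s, dist (g z) (y i) ≤ 4 * a → ∃ j : Fin N, y j = g z)) →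
      ∀ δ : ℝ, 0 < δ → δ ≤ 1 / 2 →
        ∃ κ : ℝ, 0 < κ ∧
          ∀ (N : ℕ) (y : Fin N → EuclideanSpace ℝ (Fin 3)) (i : Fin N),
            Function.Injective y →
            ¬ (∃ (a c : ℝ) (s : ℤ → ℤ)
                  (g : EuclideanSpace ℝ (Fin 3) ≃ᵃⁱ[ℝ] EuclideanSpace ℝ (Fin 3)),
                0 < a ∧ IsHaggSeq s ∧
                |c - a * Real.sqrt (2 / 3)| ≤ a * Real.sqrt (2 / 3) / 250 ∧
                (∀ j k : Fin N, j ≠ k → dist (y j) (y i) ≤ 3 * a → a / 2 ≤ dist (y j) (y k)) ∧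
                (∀ j : Fin N, dist (y j) (y i) ≤ 3 * a →
                    ∃ z ∈ barlowStacking a c s, dist (y j) (g z) ≤ δ * a) ∧
                (∀ z ∈ barlowStacking a c s, dist (g z) (y i) ≤ 3 * a →
                    ∃ j : Fin N, dist (y j) (g z) ≤ δ * a)) →
            κ ≤ h N y i := by
  intro h R r₀ h₀ hr₀ hh₀ hloc hiso hnn hlsc hcrowd hzero δ hδ _hδ2
  -- the germ-matched predicate of the goal strengthened by `4 * a ≤ R`, named once
  obtain ⟨GM, hGM⟩ : ∃ GM : (M : ℕ) → (Fin M → EuclideanSpace ℝ (Fin 3)) → Fin M → Prop,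
      ∀ M y i, GM M y i ↔
        ∃ (a c : ℝ) (s : ℤ → ℤ)
            (g : EuclideanSpace ℝ (Fin 3) ≃ᵃⁱ[ℝ] EuclideanSpace ℝ (Fin 3)),
          0 < a ∧ 4 * a ≤ R ∧ IsHaggSeq s ∧
          |c - a * Real.sqrt (2 / 3)| ≤ a * Real.sqrt (2 / 3) / 250 ∧
          (∀ j k : Fin M, j ≠ k → dist (y j) (y i) ≤ 3 * a → a / 2 ≤ dist (y j) (y k)) ∧
          (∀ j : Fin M, dist (y j) (y i) ≤ 3 * a →
              ∃ z ∈ barlowStacking a c s, dist (y j) (g z) ≤ δ * a) ∧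
          (∀ z ∈ barlowStacking a c s, dist (g z) (y i) ≤ 3 * a →
              ∃ j : Fin M, dist (y j) (g z) ≤ δ * a) :=
    ⟨_, fun _ _ _ => Iff.rfl⟩
  -- a non-negative radius bounding every relevant star
  obtain ⟨R', hRR', hR'0⟩ : ∃ R' : ℝ, R ≤ R' ∧ 0 ≤ R' := ⟨max R 0, le_max_left _ _, le_max_right _ _⟩
  /- Step 1 (Bolzano–Weierstrass): for each star size `M` and root `i` there is `κ > 0` below `h`
  on bounded `r₀`-separated stars that are not germ-matched with `4a ≤ R`. -/
  have claim : ∀ (M : ℕ) (i : Fin M), ∃ κ : ℝ, 0 < κ ∧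
      ∀ y : Fin M → EuclideanSpace ℝ (Fin 3), (∀ j, dist (y j) 0 ≤ R') →
        (∀ j k, j ≠ k → r₀ ≤ dist (y j) (y k)) → ¬ GM M y i → κ ≤ h M y i := by
    intro M i
    by_contra hcon
    have hseq : ∀ n : ℕ, ∃ y : Fin M → EuclideanSpace ℝ (Fin 3), (∀ j, dist (y j) 0 ≤ R') ∧
        (∀ j k, j ≠ k → r₀ ≤ dist (y j) (y k)) ∧ ¬ GM M y i ∧ h M y i < 1 / ((n : ℝ) + 1) := by
      intro n
      by_contra hn
      refine hcon ⟨1 / ((n : ℝ) + 1), by positivity, fun y hb hs hg => ?_⟩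
      by_contra hlt
      exact hn ⟨y, hb, hs, hg, not_le.mp hlt⟩
    choose y hyb hys hyg hyh using hseq
    -- a convergent subsequence in the compact box `(closedBall 0 R')^M`
    have hC : IsCompact (Set.pi Set.univ
        fun _ : Fin M => Metric.closedBall (0 : EuclideanSpace ℝ (Fin 3)) R') :=
      isCompact_univ_pi fun _ => isCompact_closedBall _ _
    obtain ⟨x, -, φ, hφ, hlim⟩ := hC.tendsto_subseq
      fun n => Set.mem_univ_pi.2 fun j => Metric.mem_closedBall.2 (hyb n j)
    have hcoord : ∀ j, Filter.Tendsto (fun n => y (φ n) j) Filter.atTop (nhds (x j)) :=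
      fun j => ((continuous_apply j).tendsto x).comp hlim
    -- the limit is `r₀`-separated, hence injective
    have hxsep : ∀ j k, j ≠ k → r₀ ≤ dist (x j) (x k) := fun j k hjk =>
      ge_of_tendsto' ((hcoord j).dist (hcoord k)) fun n => hys (φ n) j k hjk
    have hxinj : Function.Injective x := by
      intro j k hjk
      by_contra hne
      have h1 := hxsep j k hne
      rw [hjk, dist_self] at h1
      exact absurd h1 (not_le.mpr hr₀)
    -- lower semicontinuity and non-negativity: `h M x i = 0`
    have hx0 : h M x i = 0 := by
      refine le_antisymm (not_lt.mp fun hpos => ?_) (hnn M x i hxinj)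
      have h1 : ∀ᶠ n in Filter.atTop, h M x i / 2 < h M (y (φ n)) i :=
        hlim.eventually (lowerSemicontinuousAt_iff.1 (hlsc M x i hxinj) _ (half_lt_self hpos))
      have h2 : ∀ᶠ n : ℕ in Filter.atTop, 1 / ((n : ℝ) + 1) < h M x i / 2 :=
        (tendsto_order.1 tendsto_one_div_add_atTop_nhds_zero_nat).2 _ (half_pos hpos)
      obtain ⟨n, hn1, hn2⟩ := (h1.and h2).exists
      have h3 := hyh (φ n)
      have h4 : 1 / ((φ n : ℝ) + 1) ≤ 1 / ((n : ℝ) + 1) := by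
        gcongr
        exact_mod_cast hφ.le_apply
      linarith
    -- the perfect germ at the limit transfers to a nearby term of the subsequence
    obtain ⟨a, c, s, g, ha, h4a, hs, hwin, hm1, hm2⟩ := hzero M x i hxinj hx0
    obtain ⟨n₀, hn₀⟩ := Metric.tendsto_atTop.1 hlim (min (δ * a) (a / 8))
      (lt_min (mul_pos hδ ha) (by positivity))
    have hclose : ∀ j, dist (y (φ n₀) j) (x j) ≤ min (δ * a) (a / 8) := fun j =>
      (dist_le_pi_dist _ _ j).trans (hn₀ n₀ le_rfl).le
    obtain ⟨hsep, hma, hmb⟩ := germMatched_of_close ha (three_quarters_le_of_window ha hwin)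
      (min_le_left _ _) (min_le_right _ _) hxinj hm1 hm2 hclose
    exact hyg (φ n₀) ((hGM _ _ _).2 ⟨a, c, s, g, ha, h4a, hs, hwin, hsep, hma, hmb⟩)
  /- Step 2: one constant for all star sizes `M ≤ K` (the packing bound) and all roots. -/
  obtain ⟨K, hK⟩ : ∃ K : ℕ, K = ⌊(2 * R' / r₀ + 1) ^ 3⌋₊ := ⟨_, rfl⟩
  choose κ hκpos hκP using claim
  obtain ⟨κ₁, hκ₁, hκ₁le⟩ := exists_pos_le_of_finite
    (fun x : (Σ m : Fin (K + 1), Fin (m : ℕ)) => κ (x.1 : ℕ) x.2) fun x => hκpos x.1 x.2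
  refine ⟨min h₀ κ₁, lt_min hh₀ hκ₁, ?_⟩
  intro N y i hy hngm
  /- Step 3: the star of `i` in `y` is, up to the crowding floor, a bounded `r₀`-separated
  star of size `≤ K`; re-index (locality) and re-root at the origin (isometry invariance). -/
  by_cases hfloor : h₀ ≤ h N y i
  · exact (min_le_left _ _).trans hfloor
  have hsepR : ∀ j k, j ≠ k → dist (y j) (y i) ≤ R → dist (y k) (y i) ≤ R →
      r₀ ≤ dist (y j) (y k) := by
    intro j k hjk hj hk
    by_contra hlt
    exact hfloor (hcrowd N y i hy ⟨j, k, hjk, hj, hk, not_le.mp hlt⟩)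
  obtain ⟨S, hmemS⟩ : ∃ S : Finset (Fin N), ∀ j, j ∈ S ↔ (dist (y j) (y i) ≤ R ∨ j = i) :=
    ⟨Finset.univ.filter fun j => dist (y j) (y i) ≤ R ∨ j = i, fun j => by simp⟩
  have hiS : i ∈ S := (hmemS i).2 (Or.inr rfl)
  have hSdist : ∀ j ∈ S, dist (y j) (y i) ≤ R' := by
    intro j hj
    rcases (hmemS j).1 hj with hj | rfl
    · exact hj.trans hRR'
    · rw [dist_self]; exact hR'0
  have hSsep : ∀ j ∈ S, ∀ k ∈ S, j ≠ k → r₀ ≤ dist (y j) (y k) := by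
    intro j hj k hk hjk
    have hR0 : ∀ l, dist (y l) (y i) ≤ R → dist (y i) (y i) ≤ R := fun l hl => by
      rw [dist_self]; exact dist_nonneg.trans hl
    rcases (hmemS j).1 hj with hj | rfl <;> rcases (hmemS k).1 hk with hk | rfl
    · exact hsepR j k hjk hj hk
    · exact hsepR j _ hjk hj (hR0 j hj)
    · exact hsepR _ k hjk (hR0 k hk) hk
    · exact (hjk rfl).elim
  -- the packing bound
  have hcard : S.card < K + 1 := by
    have h1 := card_le_of_separated_of_dist_le (S.image y) (y i) hr₀ hR'0
      (fun c hc => ?_) (fun c hc d hd hcd => ?_)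
    · rw [Finset.card_image_of_injective S hy, finrank_euclideanSpace_fin] at h1
      rw [hK, Nat.lt_add_one_iff]
      exact Nat.le_floor h1
    · obtain ⟨j, hj, rfl⟩ := Finset.mem_image.1 hc
      exact hSdist j hj
    · obtain ⟨j, hj, rfl⟩ := Finset.mem_image.1 hc
      obtain ⟨k, hk, rfl⟩ := Finset.mem_image.1 hd
      exact hSsep j hj k hk fun hjk => hcd (by rw [hjk])
  -- enumerate `S`
  obtain ⟨f, hrange⟩ : ∃ f : Fin S.card ↪ Fin N, Set.range f = (S : Set (Fin N)) :=
    ⟨(S.orderEmbOfFin rfl).toEmbedding, Finset.range_orderEmbOfFin S rfl⟩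
  have hmemf : ∀ j, j ∈ Set.range f ↔ (dist (y j) (y i) ≤ R ∨ j = i) := fun j => by
    rw [hrange, Finset.mem_coe, hmemS]
  have hfmem : ∀ j', f j' ∈ S := fun j' => (hmemS _).2 ((hmemf _).1 (Set.mem_range_self j'))
  obtain ⟨i', hi'⟩ : i ∈ Set.range f := (hmemf i).2 (Or.inr rfl)
  have hloc' : h S.card (y ∘ f) i' = h N y i := by
    rw [← hi']
    refine hloc N S.card y f i' fun j hj => (hmemf j).2 (Or.inl ?_)
    rwa [hi'] at hj
  -- re-root at the origin
  obtain ⟨t, ht0⟩ : ∃ t : EuclideanSpace ℝ (Fin 3) ≃ᵃⁱ[ℝ] EuclideanSpace ℝ (Fin 3), t (y i) = 0 :=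
    ⟨(AffineIsometryEquiv.vaddConst ℝ (y i)).symm, by simp⟩
  obtain ⟨y', hy'ap⟩ : ∃ y' : Fin S.card → EuclideanSpace ℝ (Fin 3), ∀ j', y' j' = t (y (f j')) :=
    ⟨_, fun _ => rfl⟩
  have hy'i' : y' i' = t (y i) := by rw [hy'ap, hi']
  have hiso' : h S.card y' i' = h S.card (y ∘ f) i' := by
    have hy'eq : y' = t.toIsometryEquiv ∘ (y ∘ f) := by
      rw [AffineIsometryEquiv.coe_toIsometryEquiv]; exact funext hy'ap
    rw [hy'eq]
    exact hiso S.card (y ∘ f) i' t.toIsometryEquiv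
  have hbdd' : ∀ j', dist (y' j') 0 ≤ R' := fun j' => by
    rw [hy'ap, ← ht0, t.dist_map]; exact hSdist _ (hfmem j')
  have hsep' : ∀ j' k', j' ≠ k' → r₀ ≤ dist (y' j') (y' k') := fun j' k' hjk => by
    rw [hy'ap, hy'ap, t.dist_map]
    exact hSsep _ (hfmem j') _ (hfmem k') (f.injective.ne hjk)
  -- apply the compactness constant of `(S.card, i')`
  have hk₁ : κ₁ ≤ κ S.card i' := hκ₁le ⟨⟨S.card, hcard⟩, i'⟩
  rw [← hloc', ← hiso']
  refine (min_le_right _ _).trans (hk₁.trans (hκP S.card i' y' hbdd' hsep' fun hgm => ?_))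
  /- Step 4: were the re-rooted star germ-matched (with `4a ≤ R`), the star of `i` in `y` would
  be germ-matched too, since all its sites within `3a ≤ R` of `y i` are enumerated by `f`. -/
  obtain ⟨a, c, s, g', ha, h4a, hs, hwin, sep', m1', m2'⟩ := (hGM _ _ _).1 hgm
  refine hngm ⟨a, c, s, g'.trans t.symm, ha, hs, hwin, ?_, ?_, ?_⟩
  · intro j k hjk hj
    obtain ⟨j', rfl⟩ := (hmemf j).2 (Or.inl (by linarith))
    by_cases hkS : k ∈ Set.range f
    · obtain ⟨k', rfl⟩ := hkS
      have h1 := sep' j' k' (fun hjk' => hjk (by rw [hjk'])) (by rwa [hy'ap, hy'i', t.dist_map])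
      rwa [hy'ap, hy'ap, t.dist_map] at h1
    · rw [hmemf, not_or] at hkS
      have h1 : R < dist (y k) (y i) := not_le.mp hkS.1
      have h2 : dist (y k) (y i) ≤ dist (y (f j')) (y k) + dist (y (f j')) (y i) := by
        rw [dist_comm (y (f j')) (y k)]; exact dist_triangle _ _ _
      linarith
  · intro j hj
    obtain ⟨j', rfl⟩ := (hmemf j).2 (Or.inl (by linarith))
    obtain ⟨z, hz, hd⟩ := m1' j' (by rwa [hy'ap, hy'i', t.dist_map])
    refine ⟨z, hz, ?_⟩
    rw [AffineIsometryEquiv.coe_trans, Function.comp_apply,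
      ← t.dist_map (y (f j')) (t.symm (g' z)), t.apply_symm_apply, ← hy'ap]
    exact hd
  · intro z hz hzi
    rw [AffineIsometryEquiv.coe_trans, Function.comp_apply] at hzi
    have e3 : dist (g' z) (y' i') = dist (t.symm (g' z)) (y i) := by
      rw [hy'i', ← t.dist_map (t.symm (g' z)) (y i), t.apply_symm_apply]
    obtain ⟨j', hd⟩ := m2' z hz (by rw [e3]; exact hzi)
    refine ⟨f j', ?_⟩
    rw [AffineIsometryEquiv.coe_trans, Function.comp_apply,
      ← t.dist_map (y (f j')) (t.symm (g' z)), t.apply_symm_apply, ← hy'ap]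
    exact hd

end Summit.AtomisticToContinuum.Crystallization.Theorems.PricedLinkCensusTruncatedCensusGap

end
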